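import Summits.CriticalPhenomena.SAWScalingLimit.Theses.SAWReversalUpgrade
import Summits.CriticalPhenomena.SAWScalingLimit.Theorems.SAWReversalUpgradeAttachmentExistsAssembly
import Summits.CriticalPhenomena.SAWScalingLimit.Theorems.SAWReversalUpgradeAttachmentExistsGrid
import Literature.Probability.RandomPlanarGeometry.LoewnerCurveLimitDomain
import Literature.Probability.RandomPlanarGeometry.BoundaryCorrespondence
import Literature.Probability.RandomPlanarGeometry.LoewnerDescriptionProofs
import Literature.Probability.RandomPlanarGeometry.ConformalRestrictionProofs
import Literature.Probability.RandomPlanarGeometry.ConformalMapCaratheodoryProofs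
import Literature.Probability.RandomPlanarGeometry.ChordalCapacityDivergence

/-!
# `AttachmentExists` (route `SAWReversalUpgrade`, item stmt-CriticalPhenomena-18009): proof

For every Dobrushin domain `(D; a, b)`, chordal uniformizing map `φ` and endpoint approximation
`a_δ, b_δ`, there is an attachment `att` which is *standard* for all small `δ`: for every
self-avoiding walk `γ` of `Ω_δ` from `a_δ` to `b_δ`, `att δ γ` is an injective curve from `a` to
`b` with interior in `D`, whose range is the prescribed set `S₁` of the route statement (access
segment ∪ squeezed trimmed polyline ∪ exit ray) when the cut times satisfy `u₁ < v₁`, and the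
fallback arc `{a, b} ∪ φ(iℝ₊)` otherwise.

Proof: `att_core` (`…AttachmentExistsAssembly`, the abstract construction) applied to
`Φ = φ.boundaryExtension` — continuous and injective on `ℍ̄`, `0 ↦ a`, `ℍ ↦ D`, `≠ b` on `ℍ̄`,
`→ b` at `∞`, onto `closure D ∖ {b}` with continuous inverse (Carathéodory, Pommerenke (1992)
Thm. 2.6, all in the tree) — and to the polyline `P = γ.walk.toCurve (meshPoint δ)`, which stays
in `closure D`, is injective up to its dyadic tail and rests at `δ b_δ` after it
(`…AttachmentExistsGrid`). The only condition on `δ` is that `δ a_δ, δ b_δ ∈ D` with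
`‖φ⁻¹(δ a_δ)‖ < 1 < ‖φ⁻¹(δ b_δ)‖`, which holds eventually because `δ a_δ → a`, `δ b_δ → b`
(`IsEndpointApprox`) and `φ⁻¹ → 0` at `a`, `φ⁻¹ → ∞` at `b`; it separates the access segment
from the exit ray. The attachment is then chosen by the axiom of choice (`att_eventually_choice`).
-/

noncomputable section

namespace Summit.CriticalPhenomena.SAWScalingLimit.Theorems

open Set Function Filter Topology
open scoped unitInterval
open Literature.Probability.RandomPlanarGeometry Literature.Probability.LatticeModels
open Literature.Probability.Percolation (tailStart tailStart_nonneg)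

/-- Choice along a filter: from `∀ᶠ a, ∃ b, p a b` to a function `f` with `∀ᶠ a, p a (f a)`.
[folklore] -/
theorem att_eventually_choice {α : Type*} {β : α → Type*} {l : Filter α} [∀ a, Nonempty (β a)]
    {p : ∀ a, β a → Prop} (h : ∀ᶠ a in l, ∃ b, p a b) : ∃ f : ∀ a, β a, ∀ᶠ a in l, p a (f a) := by
  classical
  refine ⟨fun a => if h : ∃ b, p a b then h.choose else Classical.arbitrary _, ?_⟩
  filter_upwards [h] with a ha
  rw [dif_pos ha]
  exact ha.choose_spec

/-- The endpoints of a non-trivial reachable pair are vertices of `Ω_δ`, hence their mesh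
points lie in `Ω`. [folklore] -/
theorem att_meshPoint_mem_of_reachable {Ω : Set ℂ} {δ : ℝ} {u v : Site 2}
    (h : (discreteDomainGraph Ω δ).Reachable u v) (huv : u ≠ v) :
    meshPoint δ u ∈ Ω ∧ meshPoint δ v ∈ Ω := by
  obtain ⟨w⟩ := h
  have key : ∀ {x y : Site 2} (w : (discreteDomainGraph Ω δ).Walk x y), x ≠ y →
      meshPoint δ x ∈ Ω := by
    intro x y w hxy
    cases w with
    | nil => exact absurd rfl hxy
    | cons hadj _ =>
      exact meshDomain_subset_meshVertices Ω δ (discreteDomainGraph_adj_iff.1 hadj).2.1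
  exact ⟨key w huv, key w.reverse huv.symm⟩

/-- **The per-walk statement, eventually in `δ`.** For all small `δ > 0` and every SAW `γ` of
`Ω_δ` from `a_δ` to `b_δ` there is a curve with the properties required by `AttachmentExists`.
[folklore] -/
theorem att_key (D : DobrushinDomain) (φ : ConformalEquiv UpperHalfPlane.upperHalfPlaneSet D.carrier)
    (hφ : D.IsChordalUniformizing φ) (a b : ℝ → Site 2) (hab : SAW.IsEndpointApprox D a b) :
    ∀ᶠ δ in 𝓝[>] (0:ℝ), ∀ γ : SAW.DomainSAW D.carrier δ (a δ) (b δ), ∃ c : Curve ℂ,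
      (let a₁ := (D).pt 0
      let b₁ := (D).pt 1
      let P₁ : C(unitInterval, ℂ) := (γ.walk.toCurve (Literature.Probability.LatticeModels.meshPoint δ))
      let R₁ := fun u : ℝ => P₁ (Set.projIcc (0:ℝ) 1 zero_le_one u)
      let φ₁ := (φ).boundaryExtension
      let ψ₁ := Function.invFunOn φ₁ {z : ℂ | 0 ≤ z.im}
      let e₁ : ℝ := min δ (1/2)
      let A₁ := fun z : ℂ => (‖z‖ : ℂ) * Complex.exp (Complex.I * ((e₁ : ℂ) + (1 - 2 * (e₁ : ℂ) / (Real.pi : ℂ)) * (Complex.arg z : ℂ)))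
      let Z₁ := fun u : ℝ => @ite ℂ (R₁ u = b₁) (Classical.propDecidable _) b₁ (φ₁ (A₁ (ψ₁ (R₁ u))))
      let i₁ := sSup ({(0:ℝ)} ∪ {u | u ∈ Set.Icc (0:ℝ) 1 ∧ R₁ u = a₁})
      let j₁ := sInf ({(1:ℝ)} ∪ {u | u ∈ Set.Icc (0:ℝ) 1 ∧ R₁ u = b₁})
      let M₁ := Z₁ '' Set.Icc i₁ j₁
      let p₁ := A₁ (ψ₁ (R₁ i₁))
      let q₁ := A₁ (ψ₁ (R₁ j₁))
      let s₁ := sInf {s | s ∈ Set.Ioc (0:ℝ) 1 ∧ φ₁ ((s : ℂ) * p₁) ∈ M₁}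
      let r₁ := sSup ({(1:ℝ)} ∪ {r | 1 ≤ r ∧ R₁ j₁ ≠ b₁ ∧ φ₁ ((r : ℂ) * q₁) ∈ M₁})
      let u₁ := sInf {u | u ∈ Set.Icc i₁ j₁ ∧ Z₁ u = φ₁ ((s₁ : ℂ) * p₁)}
      let v₁ := sSup ({u | u ∈ Set.Icc i₁ j₁ ∧ R₁ j₁ = b₁ ∧ u = j₁} ∪ {u | u ∈ Set.Icc i₁ j₁ ∧ R₁ j₁ ≠ b₁ ∧ Z₁ u = φ₁ ((r₁ : ℂ) * q₁)})
      let S₁ := ((({a₁, b₁} ∪ ((fun s : ℝ => φ₁ ((s : ℂ) * p₁)) '' Set.Ioc 0 s₁)) ∪ (Z₁ '' Set.Icc u₁ v₁)) ∪ ((fun r : ℝ => φ₁ ((r : ℂ) * q₁)) '' {r | r₁ ≤ r ∧ R₁ j₁ ≠ b₁}))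
      Function.Injective c ∧ c.source = a₁ ∧ c.target = b₁ ∧ (∀ t : unitInterval, c t = a₁ ∨ c t = b₁ ∨ c t ∈ (D).carrier) ∧ (u₁ < v₁ → Set.range c = S₁) ∧ (¬ u₁ < v₁ → Set.range c = {a₁, b₁} ∪ ((fun y : ℝ => φ₁ (Complex.I * (y : ℂ))) '' Set.Ioi 0))) := by
  -- the boundary extension `Φ` of `φ` and its properties (Carathéodory)
  have hC := JordanDomain.exists_continuousOn_extension_holds
  have hab' : D.pt 0 ≠ D.pt 1 := fun h => absurd (D.pt_injective h) (by decide)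
  have haD := MarkedDomain.pt_notMem_carrier D 0
  have hbD := MarkedDomain.pt_notMem_carrier D 1
  have hH : closure UpperHalfPlane.upperHalfPlaneSet = {z : ℂ | 0 ≤ z.im} :=
    Set.ext fun z => mem_closure_upperHalfPlaneSet_iff
  have hΦc : ContinuousOn φ.boundaryExtension {z : ℂ | 0 ≤ z.im} :=
    hH ▸ JordanDomain.continuousOn_boundaryExtension_holds D.toJordanDomain φ
  have hΦi : InjOn φ.boundaryExtension {z : ℂ | 0 ≤ z.im} := JordanDomain.injOn_boundaryExtension φ
  have hΦ0 : φ.boundaryExtension 0 = D.pt 0 := hφ.boundaryExtension_zero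
  have hΦD : ∀ z : ℂ, 0 < z.im → φ.boundaryExtension z ∈ D.carrier := fun z hz => by
    rw [φ.boundaryExtension_eq (show z ∈ UpperHalfPlane.upperHalfPlaneSet from hz)]
    exact φ.mapsTo hz
  have hΦb : ∀ z : ℂ, 0 ≤ z.im → φ.boundaryExtension z ≠ D.pt 1 := fun z hz =>
    MarkedDomain.boundaryExtension_ne_pt_one hC hφ hz
  have hΦinf := hφ.tendsto_boundaryExtension_cocompact
  obtain ⟨ψ₀, hψ₀c, hψ₀Φ, -, hψ₀symm, -⟩ := hφ.exists_inverse_boundaryExtension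
  have hsurj : closure D.carrier \ {D.pt 1} ⊆ φ.boundaryExtension '' {z : ℂ | 0 ≤ z.im} :=
    fun p hp => ⟨ψ₀ p, (hψ₀Φ p hp).1, (hψ₀Φ p hp).2⟩
  have hψeq : EqOn (invFunOn φ.boundaryExtension {z : ℂ | 0 ≤ z.im}) ψ₀
      (closure D.carrier \ {D.pt 1}) := fun p hp =>
    hΦi (inv_spec hsurj hp).1 (hψ₀Φ p hp).1 ((inv_spec hsurj hp).2.trans (hψ₀Φ p hp).2.symm)
  have hψc : ContinuousOn (invFunOn φ.boundaryExtension {z : ℂ | 0 ≤ z.im})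
      (closure D.carrier \ {D.pt 1}) := hψ₀c.congr hψeq
  have hψsymm : ∀ p ∈ D.carrier, invFunOn φ.boundaryExtension {z : ℂ | 0 ≤ z.im} p = φ.symm p :=
    fun p hp => (hψeq ⟨subset_closure hp, fun h => hbD (mem_singleton_iff.1 h ▸ hp)⟩).trans
      (hψ₀symm p hp)
  -- eventually: `δ > 0`, the endpoints are distinct vertices of `Ω_δ`, near `a` and `b`
  have e1 : ∀ᶠ δ in 𝓝[>] (0 : ℝ), 0 < δ := eventually_mem_nhdsWithin
  have e2 : ∀ᶠ δ in 𝓝[>] (0 : ℝ), a δ ≠ b δ := by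
    have hd : 0 < dist (D.pt 0) (D.pt 1) := dist_pos.2 hab'
    have ht := hab.tendsto_fst.dist hab.tendsto_snd
    filter_upwards [ht.eventually (lt_mem_nhds (half_lt_self hd))] with δ hδ heq
    rw [heq, dist_self] at hδ
    linarith
  have e3 : ∀ᶠ δ in 𝓝[>] (0 : ℝ), meshPoint δ (a δ) ∈ D.carrier ∧ meshPoint δ (b δ) ∈ D.carrier := by
    filter_upwards [hab.reachable, e2] with δ hr hne
    exact att_meshPoint_mem_of_reachable hr hne
  have e4 : ∀ᶠ δ in 𝓝[>] (0 : ℝ), ‖φ.symm (meshPoint δ (a δ))‖ < 1 := by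
    have h1 : Tendsto (fun δ => meshPoint δ (a δ)) (𝓝[>] (0 : ℝ)) (𝓝[D.carrier] (D.pt 0)) :=
      tendsto_nhdsWithin_iff.2 ⟨hab.tendsto_fst, e3.mono fun δ h => h.1⟩
    have h2 := ((hφ.tendsto_symm_nhds_zero).comp h1).norm
    rw [norm_zero] at h2
    exact h2.eventually (Iio_mem_nhds zero_lt_one)
  have e5 : ∀ᶠ δ in 𝓝[>] (0 : ℝ), 1 < ‖φ.symm (meshPoint δ (b δ))‖ := by
    have h1 : Tendsto (fun δ => meshPoint δ (b δ)) (𝓝[>] (0 : ℝ)) (𝓝[D.carrier] (D.pt 1)) :=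
      tendsto_nhdsWithin_iff.2 ⟨hab.tendsto_snd, e3.mono fun δ h => h.2⟩
    have h2 := (hφ.tendsto_symm_cocompact).comp h1
    have h3 := h2 ((isCompact_closedBall (0 : ℂ) 1).compl_mem_cocompact)
    filter_upwards [h3] with δ hδ
    simpa [Metric.mem_closedBall, dist_zero_right] using hδ
  filter_upwards [e1, e3, e4, e5] with δ hδ hmem hna hnb
  intro γ
  have h01 := grid_toCurve_zero_one (meshPoint δ) γ.walk
  have hP0 : γ.walk.toCurve (meshPoint δ) 0 ∈ D.carrier := h01.1 ▸ hmem.1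
  have hP1 : γ.walk.toCurve (meshPoint δ) 1 ∈ D.carrier := h01.2 ▸ hmem.2
  have hPcl : ∀ t, γ.walk.toCurve (meshPoint δ) t ∈ closure D.carrier :=
    grid_toCurve_mem_closure γ.walk (subset_closure hmem.1)
  have hPtail : ∀ t : I, tailStart γ.walk.length ≤ (t : ℝ) →
      γ.walk.toCurve (meshPoint δ) t = γ.walk.toCurve (meshPoint δ) 1 := fun t ht => by
    rw [grid_toCurve_eq_of_tailStart_le (meshPoint δ) γ.walk ht, h01.2]
  have hPinj : ∀ s t : I, s < t → γ.walk.toCurve (meshPoint δ) s = γ.walk.toCurve (meshPoint δ) t →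
      tailStart γ.walk.length ≤ (s : ℝ) := fun s t hst heq =>
    grid_tailStart_le_of_toCurve_eq hδ.ne' γ.walk γ.isPath hst heq
  have hnorm : ‖invFunOn φ.boundaryExtension {z : ℂ | 0 ≤ z.im} (γ.walk.toCurve (meshPoint δ) 0)‖ <
      ‖invFunOn φ.boundaryExtension {z : ℂ | 0 ≤ z.im} (γ.walk.toCurve (meshPoint δ) 1)‖ := by
    rw [h01.1, h01.2, hψsymm _ hmem.1, hψsymm _ hmem.2]
    exact hna.trans hnb
  exact att_core (Dset := D.carrier) (a := D.pt 0) (b := D.pt 1) (Φ := φ.boundaryExtension)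
    (P := γ.walk.toCurve (meshPoint δ)) (δ := δ) (τ := tailStart γ.walk.length) hδ hab' haD hbD
    hΦc hΦi hΦ0 hΦD hΦb hΦinf hsurj hψc hP0 hP1 hPcl (tailStart_nonneg _) hPtail hPinj hnorm

/-- **`AttachmentExists` holds**: for every Dobrushin domain, chordal uniformizer and endpoint
approximation there is an attachment which is standard for all small `δ` (route
`SAWReversalUpgrade`, item stmt-CriticalPhenomena-18009). [folklore] -/
theorem attachmentExists_proof :
    Summit.CriticalPhenomena.SAWScalingLimit.Theses.SAWReversalUpgrade.AttachmentExists := by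
  intro D φ hφ a b hab
  have h1 := (att_key D φ hφ a b hab).mono fun δ h => Classical.axiomOfChoice h
  haveI : Nonempty (Curve ℂ) := ⟨Curve.const 0⟩
  exact att_eventually_choice h1

end Summit.CriticalPhenomena.SAWScalingLimit.Theorems
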